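import Summits.KontsevichZagierPeriods.KontsevichZagierPeriods.Theses.TorsionLogs
import Summits.KontsevichZagierPeriods.KontsevichZagierPeriods.Theorems.TorsionLogsNeronTorsionSector
import Summits.KontsevichZagierPeriods.KontsevichZagierPeriods.Theorems.TorsionLogsTorsionSectorCompleteReductions
import Literature.NumberTheory.Transcendental.KZKernelConjectureForms

/-!
# Crux `TorsionSectorComplete` (stmt-KontsevichZagierPeriods-14212) — line `NeronTorsionTwoPoint`
# (forward generator G1 `next-rung` over the floor `NeronTorsionPrimitiveChain`, unit fwd2-rung-KontsevichZagierPeriods-01-g2)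

Route `TorsionLogs` (route-KontsevichZagierPeriods-TorsionLogs; `closes (h₁ : NeronTorsionSector)
(h₂ : TorsionSectorComplete) : KontsevichZagierPeriods`; `h₁` CLOSED through the primitive chain
`…Cruxes.NeronTorsionSector.Translation.stub_assembly` = item stmt-17981 `NeronTorsionPrimitiveChain` (the SEED);
`h₂` open, conjecture-grade, in tree `TorsionSectorComplete ↔ KontsevichZagierPeriods` given `h₁`).

## THE RUNG `NeronTorsionTwoPoint := ∀ N', NeronTorsionChainFrom N'` — floor = member `N' = 2`

FLOOR (seed g1-KontsevichZagierPeriods-17981). For a real Weierstrass curve `y² = f(x) = 4x³ − g₂x − g₃`, `0 < e₁` the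
largest root, and a real `N`-torsion point `P` of the identity component with `N·u_P = a·ω₁`, the explicit chain of
KZ moves `q²•[rI(T→P)] + p²•[rP] − c•[1<t<B, dt/t] ∈ KZ.relations` (`p/q = 1/2 − a/N`), where
`rI(T→P) = [e₁ < x′ < x < x_P, x′dx′dx/(y′y)]` is the length-two iterated integral whose LOWER CORNER is the
2-torsion point `T = (e₁, 0)` and `rP = [(e₁,∞)², dx/y · (g₂x′+2g₃)dx′/(2x′²y′)]` carries `ω₁η₁`.

THE ONE MOVE (parameter): the lower corner `T` (order `N' = 2`) ↦ an arbitrary real `N'`-torsion point `Q` of the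
identity component, `e₁ ≤ x_Q < x_P`, `N'·u_Q = a'·ω₁`. New boundary term: `(2qp)•[rW]`, `rW = [(e₁,∞), ϱ dx/y]`, where
`ϱ` is the Néron datum of `Q` fixed by the second-kind hypothesis `∫_{e₁}^{x_Q} x dx/y = ϱ + (a'/N' − 1/2)·∫(g₂x+2g₃)dx/(2x²y)`
(so `ϱ = ζ(u_Q) − (2u_Q/ω₁)η₁`, ALGEBRAIC at torsion `Q` by Frobenius–Stickelberger; `= (12x_Q² − g₂)/(12y_Q)` at
3-torsion, checked to 15 digits on `y² = 4x³ − 28x + 24`, NOTES.md §numerics), and `p/q = a'/N' − a/N`.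
In value terms the rung realises `q²·(Λ(u_Q) − Λ(u_P)) = c·log B`, `Λ(u) = log σ(u) − (η₁/ω₁)u²` the periodic
Néron function: the POLARISATION of the floor's quadratic identity (the floor is `u_Q = ω₁/2`, `ϱ = 0`, no mixed term).

* F3 WITNESS (`Lines/NeronTorsionTwoPoint_special.lean`, rc 0, 0 sorry): `NeronTorsionChainFrom 2 ↔ NeronTorsionPrimitiveChain`
  (`N' = 2` forces `a' = 1`, `x_Q = e₁`, `ϱ = 0`; the member IS the seed `stub_assembly`).
* F4 ON PATH (`Lines/NeronTorsionTwoPoint_onpath.lean`, rc 0, 0 sorry, axioms standard, ~470 lines):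
  `KontsevichZagierPeriods → NeronTorsionTwoPoint` — NOT by a value hypothesis (the rung is a primitive chain with no value
  input) but by COMPUTING the value of the two-point element from the floor at `P` and at `Q`, the landed concatenation
  of triangles `triangleConcatenation_proof`, Fubini on the rectangle and the two torsion data: the `ω₁η₁`- and
  `ϱω₁`-terms cancel identically, `value = (q²c_P/q_P²) log B_P − (q²c_Q/q_Q²) log B_Q`, packaged by the landed
  `exists_carrier_of_logFamily`; only then Conjecture 1 (kernel form) is invoked once.
* REAL STEP: the floor does not give the rung — integrally, `floor(P) − floor(Q)` yields only `D•(X − c[rB])` with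
  `D = q_P² q_Q²` (e.g. `N=3,a=1,N'=5,a'=2`: `q = 15`, `q_P = 6`, `36 ∤ 225`): dividing by `D` in `FormalRep ⧸ relations`
  IS saturation, i.e. Conjecture-1-strength. A direct chain between the two REGULAR columns is needed.
* WHY THE FLOOR'S PROOF STOPS (Q4): `Theorems/TorsionLogsNeronTorsionSectorAssemblyMain.lean` — `asmS2_corner` (the corner
  slice at `x_m = e₁` uses `f e₁ = 0`: reps `T0/Th0/Thl/C10`), `asmX_fold` (`AssemblyXFold.lean`: the fold of the grid at
  the 2-torsion corner), and `chain_to_logClass … hΘ hB` via `stub_periodSymmetry` (reflection `qv j = qv (n−j)` about `T`);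
  at a REGULAR node `x_Q = x aa'` (`f x_Q ≠ 0`) the column slice is a first-kind × second-kind product whose second-kind
  factor has the algebraic residue `ϱ` — it is not killed by a fold, it must be IDENTIFIED (stub 2).

## Stubs (3) and composition

* `stub_twoPointGrid` (M) — the COMMON TORSION GRID: the floor's `stub_gridData` package (even mesh `ω₁/n`, nodes
  `x k = X(kω₁/n)` with algebraic coordinates, chord/translation maps `τ, τ'` by the generator `(x 1, y 1)`) carrying BOTH
  points, `x aa = x_P`, `x aa' = x_Q`, `aa < aa' < m`. New input over the floor: algebraicity of `X(ω₁/lcm(N,N'))` from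
  `P` AND `Q` (Bezout in the group law, `gridData_alg_add`, then `gridData_alg_half`).
* `stub_regularEndChain` (L–XL, the rung's content) — ON that grid, the two-point element is congruent modulo
  `KZ.relations` to an INTEGER combination of log carriers `[αᵢ<t<βᵢ, dt/t]` with algebraic ends: the translation-cocycle
  telescoping of the floor run from column `aa'` to column `aa` (blocks `AssemblyColumns/Rows/XSteps/Decomp*` are
  corner-free and re-usable), plus the NEW regular-end identification of the boundary column class at `aa'` with
  `(2qp)•[rW] +` logs through the second-kind datum of `Q` (replacing `asmS2_corner`/`asmX_fold`/`stub_periodSymmetry`).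
* `stub_twoPointComplete` — RESIDUAL `TwoPointSectorComplete`: Conjecture 1 for rational pairs modulo the sector ENLARGED by
  the tied two-point elements; weaker than the crux (`twoPointSectorComplete_of_torsionSectorComplete`); conjecture-grade,
  declared `residual` (forward contract: the distance rung → Statement is named, not attacked).
* PROVED here (no `sorry`): `neronTorsionTwoPoint_of` (the rung from stubs 1–2: degenerate member `x_Q = e₁` = the floor
  `stub_assembly` BY NAME; regular member = grid → chain → `exists_carrier_of_logFamily`), `closure_twoPointTied_le_relations`
  (rung + soundness + the landed `interval_log_relation_mem_relations`), `twoPointSectorComplete_of_torsionSectorComplete`,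
  and the composition `TorsionSectorComplete_of` concluding the crux BY NAME.

Disproof used: none exists for stmt-14212 (`ledger crux ls`: no `Disproof.lean`, no `Negative/`). Negatives index: 1 entry
(stmt-5394 `KinematicFormulas`), unrelated. Nearest filed line on this crux: `shifted_eta_sector` (rung
`NeronTorsionShiftedSectors`: the carrier pole moved, hypothesis `0 < e₁` generalised) — a DIFFERENT one-move rung over the
same floor (its own `gap_after` names "two torsion corners" as the next rung: this line types it); the two moves commute.

[cite: KontsevichZagier2001, §1.2] [cite: Lang1983, Ch. 13 Thm 1.1] [cite: Lawden1989, §6.8, §6.11–6.12]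
-/

noncomputable section

open Set MeasureTheory
open Literature.NumberTheory.Transcendental Literature.ModelTheory.ExponentialFields
open Summit.KontsevichZagierPeriods.KontsevichZagierPeriods.Theses.TorsionLogs (TorsionSectorComplete)
open Summit.KontsevichZagierPeriods.HyperbolicBloch.OffTetraSectorKernel (interval_log_relation_mem_relations)
open Summit.KontsevichZagierPeriods.KontsevichZagierPeriods.Cruxes.NeronTorsionSector.Translation (stub_assembly
  stub_realDictionary logRep_value isAlgebraic_endpoints_of_isSemialgebraic_Ioo isSemialgebraic_proj_triangle
  isAlgebraic_mul_of_integralRep exists_carrier_of_logFamily)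

-- `Summit.KontsevichZagierPeriods.KontsevichZagierPeriods.…` is the tree's mandated layout (single-conjunct summit).
set_option linter.dupNamespace false

namespace Summit.KontsevichZagierPeriods.KontsevichZagierPeriods.Cruxes.TorsionSectorComplete.NeronTorsionTwoPoint

/-! ### The rung family (verbatim as in `Lines/NeronTorsionTwoPoint_special.lean` / `_onpath.lean`) -/

/-- **Rung family member `N'`: Néron–torsion chains from an `N'`-torsion lower end point.** For the
curve/torsion data of the floor (upper end point `P` of order `N ≥ 3`, sheet `0 < 2a < N`) and a real
`N'`-torsion point `Q = (x_Q, y_Q)` of the identity component with `e₁ ≤ x_Q < x_P`, first-kind datum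
`N'·∫_{x_Q}^∞ dx/√f = a'·ω₁` (`0 < 2a' ≤ N'`) and second-kind datum
`∫_{e₁}^{x_Q} x dx/√f = ϱ + (a'/N' − 1/2)·η₁`, and `ρ₂ = a'/N' − a/N = p/q` in lowest terms: for
representations `rI = [x_Q < x′ < x < x_P, x′dx′dx/(√f(x′)√f(x))]`, `rP = [(e₁,∞)², dx/√f(x) · (g₂x′+2g₃)dx′/(2x′²√f(x′))]`,
`rW = [(e₁,∞), ϱ dx/√f(x)]`, there are `c ∈ ℤ`, a real algebraic `B > 1` and `rB = [1<t<B, dt/t]` with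
`q²•[rI] + p²•[rP] + (2qp)•[rW] − c•[rB] ∈ KZ.relations`. (`N' = 2` forces `Q = (e₁,0)`, `a' = 1`, `ϱ = 0`:
the floor `NeronTorsionPrimitiveChain`.) -/
def NeronTorsionChainFrom (N' : ℕ) : Prop :=
  ∀ (g₂ g₃ e₁ xP yP xQ yQ ϱ : ℝ) (N a a' p q : ℕ) (f : ℝ → ℝ),
    (∀ x, f x = 4 * x ^ 3 - g₂ * x - g₃) → g₂ ^ 3 - 27 * g₃ ^ 2 ≠ 0 → f e₁ = 0 → 0 < e₁ →
    (∀ x, e₁ < x → 0 < f x) → e₁ < xP → yP ^ 2 = f xP → 3 ≤ N → 0 < a → 2 * a < N →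
    (∀ hns : (⟨0, 0, 0, -g₂ / 4, -g₃ / 4⟩ : WeierstrassCurve ℝ).toAffine.Nonsingular xP (yP / 2),
      addOrderOf (WeierstrassCurve.Affine.Point.some xP (yP / 2) hns) = N) →
    (N : ℝ) * (∫ x in Set.Ioi xP, (Real.sqrt (f x))⁻¹) = a * (2 * ∫ x in Set.Ioi e₁, (Real.sqrt (f x))⁻¹) →
    e₁ ≤ xQ → xQ < xP → yQ ^ 2 = f xQ → 2 ≤ N' → 0 < a' → 2 * a' ≤ N' →
    (∀ hns : (⟨0, 0, 0, -g₂ / 4, -g₃ / 4⟩ : WeierstrassCurve ℝ).toAffine.Nonsingular xQ (yQ / 2),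
      addOrderOf (WeierstrassCurve.Affine.Point.some xQ (yQ / 2) hns) = N') →
    (N' : ℝ) * (∫ x in Set.Ioi xQ, (Real.sqrt (f x))⁻¹) = a' * (2 * ∫ x in Set.Ioi e₁, (Real.sqrt (f x))⁻¹) →
    (∫ x in Set.Ioo e₁ xQ, x / Real.sqrt (f x)) =
      ϱ + ((a' : ℝ) / N' - 1 / 2) * ∫ x in Set.Ioi e₁, (g₂ * x + 2 * g₃) / (2 * x ^ 2 * Real.sqrt (f x)) →
    Nat.Coprime p q → (q : ℤ) * ((a' : ℤ) * N - (a : ℤ) * N') = (p : ℤ) * ((N : ℤ) * N') →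
    ∀ (rI rP : Literature.NumberTheory.Transcendental.KZ.IntegralRep 2)
      (rW : Literature.NumberTheory.Transcendental.KZ.IntegralRep 1),
    rI.domain = {z | xQ < z 1 ∧ z 1 < z 0 ∧ z 0 < xP} →
    Set.EqOn rI.integrand (fun z => z 1 / (Real.sqrt (f (z 1)) * Real.sqrt (f (z 0)))) rI.domain →
    rP.domain = {z | e₁ < z 0 ∧ e₁ < z 1} →
    Set.EqOn rP.integrand
      (fun z => (Real.sqrt (f (z 0)))⁻¹ * ((g₂ * z 1 + 2 * g₃) / (2 * (z 1) ^ 2 * Real.sqrt (f (z 1))))) rP.domain →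
    rW.domain = {t | e₁ < t 0} →
    Set.EqOn rW.integrand (fun t => ϱ / Real.sqrt (f (t 0))) rW.domain →
    ∃ (c : ℤ) (B : ℝ) (rB : Literature.NumberTheory.Transcendental.KZ.IntegralRep 1), 1 < B ∧ IsAlgebraic ℚ B ∧
    rB.domain = {t | 1 < t 0 ∧ t 0 < B} ∧ Set.EqOn rB.integrand (fun t => (t 0)⁻¹) rB.domain ∧
    ((q : ℤ) ^ 2) • Literature.NumberTheory.Transcendental.KZ.of rI +
      ((p : ℤ) ^ 2) • Literature.NumberTheory.Transcendental.KZ.of rP +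
      (2 * (q : ℤ) * p) • Literature.NumberTheory.Transcendental.KZ.of rW -
      c • Literature.NumberTheory.Transcendental.KZ.of rB ∈ Literature.NumberTheory.Transcendental.KZ.relations

/-- **The rung `NeronTorsionTwoPoint`**: Néron–torsion chains between ANY two real torsion points
`Q`, `P` of the identity component (`x_Q < x_P`) — every member of the family `NeronTorsionChainFrom N'`.
The floor is the member `N' = 2`. -/
def NeronTorsionTwoPoint : Prop := ∀ N' : ℕ, NeronTorsionChainFrom N'

/-! ### The new object: a common torsion grid carrying `P` and `Q` -/

/-- **The common-grid package** — the conclusion of the floor's `stub_gridData`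
(`Theorems/TorsionLogsNeronTorsionSectorStubGridData.lean:60–86`) VERBATIM, with a second marked index `aa'`
(`aa < aa' < m`, `x aa' = x_Q`, tie `2N'(m − aa') = n(N' − 2a')`): an even torsion grid `x k = X(kω₁/n)`, `y k = Y(kω₁/n)`
of the identity component with algebraic nodes, the corner `x m = e₁`, the chord recursion by the generator
`(x 1, y 1)` and the two translation maps `τ` (by `+ω₁/n`) and `τ'` (by `−ω₁/n`) with their cell images.
[cite: Lawden1989, §6.8] -/
def TwoPointGridPackage (g₂ e₁ xP xQ : ℝ) (N a N' a' : ℕ) (f : ℝ → ℝ) (n m aa aa' : ℕ) (x y : ℕ → ℝ) : Prop :=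
  12 ≤ n ∧ n = 2 * m ∧ 1 ≤ aa ∧ aa < aa' ∧ aa' < m ∧
      2 * N * (m - aa) = n * (N - 2 * a) ∧ 2 * N' * (m - aa') = n * (N' - 2 * a') ∧
      x m = e₁ ∧ y m = 0 ∧ x aa = xP ∧ x aa' = xQ ∧
      (∀ k, 1 ≤ k → k < n → IsAlgebraic ℚ (x k) ∧ IsAlgebraic ℚ (y k) ∧ y k ^ 2 = f (x k) ∧ e₁ ≤ x k) ∧
      (∀ k, 1 ≤ k → k < m → e₁ < x k ∧ y k < 0) ∧
      (∀ k, 1 ≤ k → k < n → x (n - k) = x k ∧ y (n - k) = -y k) ∧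
      (∀ k, 1 ≤ k → k < m → x (k + 1) < x k) ∧
      (∀ k, 1 ≤ k → k + 1 < n → y k + y 1 ≠ 0 ∧
        x (k + 1) = ((4 * x k ^ 2 + 4 * x k * x 1 + 4 * x 1 ^ 2 - g₂) / (y k + y 1)) ^ 2 / 4 - x k - x 1 ∧
        y (k + 1) = -(y k + (4 * x k ^ 2 + 4 * x k * x 1 + 4 * x 1 ^ 2 - g₂) / (y k + y 1) * (x (k + 1) - x k))) ∧
      MeasureTheory.IntegrableOn (fun t => (Real.sqrt (f t))⁻¹) (Set.Ioi e₁) ∧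
      (∀ τ : ℝ → ℝ,
        τ = (fun t => ((4 * t ^ 2 + 4 * t * x 1 + 4 * x 1 ^ 2 - g₂) / (-Real.sqrt (f t) + y 1)) ^ 2 / 4 - t - x 1) →
        (∀ t, e₁ < t → -Real.sqrt (f t) + y 1 ≠ 0) ∧ ContinuousOn τ (Set.Ici e₁) ∧
        StrictMonoOn τ (Set.Ici (x 1)) ∧ τ '' Set.Ioi (x 1) = Set.Ioo (x 2) (x 1) ∧
        (∀ k, 1 ≤ k → k + 2 ≤ m → StrictMonoOn τ (Set.Icc (x (k + 1)) (x k)) ∧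
          τ '' Set.Ioo (x (k + 1)) (x k) = Set.Ioo (x (k + 2)) (x (k + 1)) ∧
          τ (x k) = x (k + 1) ∧ τ (x (k + 1)) = x (k + 2)) ∧
        StrictAntiOn τ (Set.Icc e₁ (x (m - 1))) ∧ τ '' Set.Ioo e₁ (x (m - 1)) = Set.Ioo e₁ (x (m - 1)) ∧
        τ e₁ = x (m - 1) ∧ τ (x (m - 1)) = e₁) ∧
      (∀ τ' : ℝ → ℝ,
        τ' = (fun t => ((4 * t ^ 2 + 4 * t * x 1 + 4 * x 1 ^ 2 - g₂) / (Real.sqrt (f t) + y 1)) ^ 2 / 4 - t - x 1) →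
        (∀ t, e₁ ≤ t → t < x 1 → Real.sqrt (f t) + y 1 ≠ 0) ∧ ContinuousOn τ' (Set.Ico e₁ (x 1)) ∧
        StrictMonoOn τ' (Set.Ico (x 2) (x 1)) ∧ τ' '' Set.Ioo (x 2) (x 1) = Set.Ioi (x 1) ∧ τ' (x 2) = x 1 ∧
        (∀ k, 2 ≤ k → k + 1 ≤ m → StrictMonoOn τ' (Set.Icc (x (k + 1)) (x k)) ∧
          τ' '' Set.Ioo (x (k + 1)) (x k) = Set.Ioo (x k) (x (k - 1)) ∧
          τ' (x (k + 1)) = x k ∧ τ' (x k) = x (k - 1)))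

/-- **Stub 1's statement `TwoPointGrid`**: two real torsion points `P` (order `N`, `N u_P = a ω₁`) and `Q` (order `N'`,
`N' u_Q = a' ω₁`) of the identity component, `e₁ < x_Q < x_P`, with algebraic `g₂, g₃, e₁, x_P, x_Q`, sit on ONE torsion
grid package. [cite: Lawden1989, §6.8] -/
def TwoPointGrid : Prop :=
  ∀ (g₂ g₃ e₁ xP xQ : ℝ) (N a N' a' : ℕ) (f : ℝ → ℝ),
    (∀ x, f x = 4 * x ^ 3 - g₂ * x - g₃) → g₂ ^ 3 - 27 * g₃ ^ 2 ≠ 0 → f e₁ = 0 → 0 < e₁ →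
    (∀ x, e₁ < x → 0 < f x) → IsAlgebraic ℚ g₂ → IsAlgebraic ℚ g₃ → IsAlgebraic ℚ e₁ →
    e₁ < xP → IsAlgebraic ℚ xP → 3 ≤ N → 0 < a → 2 * a < N →
    (N : ℝ) * (∫ x in Set.Ioi xP, (Real.sqrt (f x))⁻¹) = a * (2 * ∫ x in Set.Ioi e₁, (Real.sqrt (f x))⁻¹) →
    e₁ < xQ → xQ < xP → IsAlgebraic ℚ xQ → 3 ≤ N' → 0 < a' → 2 * a' < N' →
    (N' : ℝ) * (∫ x in Set.Ioi xQ, (Real.sqrt (f x))⁻¹) = a' * (2 * ∫ x in Set.Ioi e₁, (Real.sqrt (f x))⁻¹) →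
    ∃ (n m aa aa' : ℕ) (x y : ℕ → ℝ), TwoPointGridPackage g₂ e₁ xP xQ N a N' a' f n m aa aa' x y

/-- **Stub 2's statement `RegularEndChain`**: on a common grid, the two-point Néron–torsion element
`X = q²•[rI(Q→P)] + p²•[rP] + (2qp)•[rW]` (regular member `e₁ < x_Q`) is congruent modulo `KZ.relations` to an INTEGER
combination of log carriers `[αᵢ < t < βᵢ, dt/t]` with real algebraic ends — the input shape of the landed
`exists_carrier_of_logFamily`. [cite: KontsevichZagier2001, §1.2] [cite: Lang1983, Ch. 13 Thm 1.1] -/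
def RegularEndChain : Prop :=
  ∀ (g₂ g₃ e₁ xP yP xQ yQ ϱ : ℝ) (N a N' a' p q : ℕ) (f : ℝ → ℝ),
    (∀ x, f x = 4 * x ^ 3 - g₂ * x - g₃) → g₂ ^ 3 - 27 * g₃ ^ 2 ≠ 0 → f e₁ = 0 → 0 < e₁ →
    (∀ x, e₁ < x → 0 < f x) → e₁ < xP → yP ^ 2 = f xP → 3 ≤ N → 0 < a → 2 * a < N →
    (∀ hns : (⟨0, 0, 0, -g₂ / 4, -g₃ / 4⟩ : WeierstrassCurve ℝ).toAffine.Nonsingular xP (yP / 2),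
      addOrderOf (WeierstrassCurve.Affine.Point.some xP (yP / 2) hns) = N) →
    (N : ℝ) * (∫ x in Set.Ioi xP, (Real.sqrt (f x))⁻¹) = a * (2 * ∫ x in Set.Ioi e₁, (Real.sqrt (f x))⁻¹) →
    e₁ < xQ → xQ < xP → yQ ^ 2 = f xQ → 3 ≤ N' → 0 < a' → 2 * a' < N' →
    (∀ hns : (⟨0, 0, 0, -g₂ / 4, -g₃ / 4⟩ : WeierstrassCurve ℝ).toAffine.Nonsingular xQ (yQ / 2),
      addOrderOf (WeierstrassCurve.Affine.Point.some xQ (yQ / 2) hns) = N') →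
    (N' : ℝ) * (∫ x in Set.Ioi xQ, (Real.sqrt (f x))⁻¹) = a' * (2 * ∫ x in Set.Ioi e₁, (Real.sqrt (f x))⁻¹) →
    (∫ x in Set.Ioo e₁ xQ, x / Real.sqrt (f x)) =
      ϱ + ((a' : ℝ) / N' - 1 / 2) * ∫ x in Set.Ioi e₁, (g₂ * x + 2 * g₃) / (2 * x ^ 2 * Real.sqrt (f x)) →
    Nat.Coprime p q → (q : ℤ) * ((a' : ℤ) * N - (a : ℤ) * N') = (p : ℤ) * ((N : ℤ) * N') →
    IsAlgebraic ℚ g₂ → IsAlgebraic ℚ g₃ → IsAlgebraic ℚ e₁ → IsAlgebraic ℚ xP → IsAlgebraic ℚ xQ →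
    ∀ (n m aa aa' : ℕ) (x y : ℕ → ℝ), TwoPointGridPackage g₂ e₁ xP xQ N a N' a' f n m aa aa' x y →
    ∀ (rI rP : KZ.IntegralRep 2) (rW : KZ.IntegralRep 1),
    rI.domain = {z | xQ < z 1 ∧ z 1 < z 0 ∧ z 0 < xP} →
    Set.EqOn rI.integrand (fun z => z 1 / (Real.sqrt (f (z 1)) * Real.sqrt (f (z 0)))) rI.domain →
    rP.domain = {z | e₁ < z 0 ∧ e₁ < z 1} →
    Set.EqOn rP.integrand
      (fun z => (Real.sqrt (f (z 0)))⁻¹ * ((g₂ * z 1 + 2 * g₃) / (2 * (z 1) ^ 2 * Real.sqrt (f (z 1))))) rP.domain →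
    rW.domain = {t | e₁ < t 0} →
    Set.EqOn rW.integrand (fun t => ϱ / Real.sqrt (f (t 0))) rW.domain →
    ∃ (κ : ℕ) (α β : Fin κ → ℝ) (ε : Fin κ → ℤ) (cs : Fin κ → KZ.IntegralRep 1),
      (∀ i, 0 < α i) ∧ (∀ i, α i ≤ β i) ∧ (∀ i, IsAlgebraic ℚ (α i)) ∧ (∀ i, IsAlgebraic ℚ (β i)) ∧
      (∀ i, (cs i).domain = {t | α i < t 0 ∧ t 0 < β i}) ∧
      (∀ i, Set.EqOn (cs i).integrand (fun t => 1 / t 0) (cs i).domain) ∧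
      (((q : ℤ) ^ 2) • KZ.of rI + ((p : ℤ) ^ 2) • KZ.of rP + (2 * (q : ℤ) * p) • KZ.of rW) -
        ∑ i, ε i • KZ.of (cs i) ∈ KZ.relations

/-! ### The enlarged sector and the residual -/

/-- The crux's own sector `T`: the tied Néron–torsion elements (the set inside `TorsionSectorComplete`, verbatim). -/
def TorsionTied : Set KZ.FormalRep :=
  {d : Literature.NumberTheory.Transcendental.KZ.FormalRep | ∃ (g₂ g₃ e₁ xP yP α : ℝ) (N a : ℕ) (M k m : ℤ) (f : ℝ → ℝ) (rI rP : Literature.NumberTheory.Transcendental.KZ.IntegralRep 2) (rL : Literature.NumberTheory.Transcendental.KZ.IntegralRep 1), (∀ x, f x = 4 * x ^ 3 - g₂ * x - g₃) ∧ g₂ ^ 3 - 27 * g₃ ^ 2 ≠ 0 ∧ f e₁ = 0 ∧ 0 < e₁ ∧ (∀ x, e₁ < x → 0 < f x) ∧ e₁ < xP ∧ yP ^ 2 = f xP ∧ 3 ≤ N ∧ 0 < a ∧ 2 * a < N ∧ 4 * (N : ℤ) ^ 2 * k = M * ((N : ℤ) - 2 * (a : ℤ)) ^ 2 ∧ (∀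 hns : (⟨0, 0, 0, -g₂ / 4, -g₃ / 4⟩ : WeierstrassCurve ℝ).toAffine.Nonsingular xP (yP / 2), addOrderOf (WeierstrassCurve.Affine.Point.some xP (yP / 2) hns) = N) ∧ (N : ℝ) * (∫ x in Set.Ioi xP, (Real.sqrt (f x))⁻¹) = a * (2 * ∫ x in Set.Ioi e₁, (Real.sqrt (f x))⁻¹) ∧ 1 < α ∧ rI.domain = {z | e₁ < z 1 ∧ z 1 < z 0 ∧ z 0 < xP} ∧ Set.EqOn rI.integrand (fun z => z 1 / (Real.sqrt (f (z 1)) * Real.sqrt (f (z 0)))) rI.domain ∧ rP.domain = {z | e₁ < z 0 ∧ e₁ < z 1} ∧ Set.EqOn rP.integrand (fun z => (Real.sqrt (f (z 0)))⁻¹ * ((g₂ * z 1 + 2 * g₃) / (2 * (z 1) ^ 2 * Real.sqrt (f (z 1))))) rP.domain ∧ rL.domain = {t | 1 < t 0 ∧ t 0 < α} ∧ Set.EqOn rL.integrand (fun t => (t 0)⁻¹) rL.domain ∧ (M : ℝ) * rI.value + k * rP.value = m * rL.value ∧ d = M • Literature.NumberTheory.Transcendental.KZ.of rI + k • Literature.NumberTheory.Transcendental.KZ.of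 rP - m • Literature.NumberTheory.Transcendental.KZ.of rL}

/-- Sanity: the crux is completeness modulo `relations ⊔ closure TorsionTied` (definitional). -/
theorem torsionSectorComplete_iff : TorsionSectorComplete ↔
    ∀ ⦃n m : ℕ⦄ (r : KZ.IntegralRep n) (r' : KZ.IntegralRep m), r.IsRational → r'.IsRational →
      r.value = r'.value → KZ.of r - KZ.of r' ∈ KZ.relations ⊔ AddSubgroup.closure TorsionTied :=
  Iff.rfl

/-- The TIED TWO-POINT ELEMENTS `T₂`: the rung's elements `q²•[rI] + p²•[rP] + (2qp)•[rW] − c•[rB]` (any `N'`) whose value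
vanishes (`q²·I + p²·ω₁η₁… = c·log B`). [cite: KontsevichZagier2001, §1.2] -/
def TwoPointTied : Set KZ.FormalRep :=
  {d | ∃ (N' : ℕ) (g₂ g₃ e₁ xP yP xQ yQ ϱ : ℝ) (N a a' p q : ℕ) (f : ℝ → ℝ) (rI rP : KZ.IntegralRep 2)
      (rW rB : KZ.IntegralRep 1) (c : ℤ) (B : ℝ),
      (∀ x, f x = 4 * x ^ 3 - g₂ * x - g₃) ∧ g₂ ^ 3 - 27 * g₃ ^ 2 ≠ 0 ∧ f e₁ = 0 ∧ 0 < e₁ ∧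
      (∀ x, e₁ < x → 0 < f x) ∧ e₁ < xP ∧ yP ^ 2 = f xP ∧ 3 ≤ N ∧ 0 < a ∧ 2 * a < N ∧
      (∀ hns : (⟨0, 0, 0, -g₂ / 4, -g₃ / 4⟩ : WeierstrassCurve ℝ).toAffine.Nonsingular xP (yP / 2),
        addOrderOf (WeierstrassCurve.Affine.Point.some xP (yP / 2) hns) = N) ∧
      (N : ℝ) * (∫ x in Set.Ioi xP, (Real.sqrt (f x))⁻¹) = a * (2 * ∫ x in Set.Ioi e₁, (Real.sqrt (f x))⁻¹) ∧
      e₁ ≤ xQ ∧ xQ < xP ∧ yQ ^ 2 = f xQ ∧ 2 ≤ N' ∧ 0 < a' ∧ 2 * a' ≤ N' ∧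
      (∀ hns : (⟨0, 0, 0, -g₂ / 4, -g₃ / 4⟩ : WeierstrassCurve ℝ).toAffine.Nonsingular xQ (yQ / 2),
        addOrderOf (WeierstrassCurve.Affine.Point.some xQ (yQ / 2) hns) = N') ∧
      (N' : ℝ) * (∫ x in Set.Ioi xQ, (Real.sqrt (f x))⁻¹) = a' * (2 * ∫ x in Set.Ioi e₁, (Real.sqrt (f x))⁻¹) ∧
      (∫ x in Set.Ioo e₁ xQ, x / Real.sqrt (f x)) =
        ϱ + ((a' : ℝ) / N' - 1 / 2) * ∫ x in Set.Ioi e₁, (g₂ * x + 2 * g₃) / (2 * x ^ 2 * Real.sqrt (f x)) ∧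
      Nat.Coprime p q ∧ (q : ℤ) * ((a' : ℤ) * N - (a : ℤ) * N') = (p : ℤ) * ((N : ℤ) * N') ∧
      rI.domain = {z | xQ < z 1 ∧ z 1 < z 0 ∧ z 0 < xP} ∧
      Set.EqOn rI.integrand (fun z => z 1 / (Real.sqrt (f (z 1)) * Real.sqrt (f (z 0)))) rI.domain ∧
      rP.domain = {z | e₁ < z 0 ∧ e₁ < z 1} ∧
      Set.EqOn rP.integrand
        (fun z => (Real.sqrt (f (z 0)))⁻¹ * ((g₂ * z 1 + 2 * g₃) / (2 * (z 1) ^ 2 * Real.sqrt (f (z 1))))) rP.domain ∧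
      rW.domain = {t | e₁ < t 0} ∧ Set.EqOn rW.integrand (fun t => ϱ / Real.sqrt (f (t 0))) rW.domain ∧
      1 < B ∧ IsAlgebraic ℚ B ∧ rB.domain = {t | 1 < t 0 ∧ t 0 < B} ∧
      Set.EqOn rB.integrand (fun t => (t 0)⁻¹) rB.domain ∧
      (q : ℝ) ^ 2 * rI.value + (p : ℝ) ^ 2 * rP.value + 2 * (q : ℝ) * p * rW.value = c * rB.value ∧
      d = ((q : ℤ) ^ 2) • KZ.of rI + ((p : ℤ) ^ 2) • KZ.of rP + (2 * (q : ℤ) * p) • KZ.of rW - c • KZ.of rB}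

/-- **RESIDUAL `TwoPointSectorComplete`**: Conjecture 1 for rational pairs MODULO the sector enlarged by the tied
two-point elements, `relations ⊔ closure T ⊔ closure T₂`. [cite: KontsevichZagier2001, §1.2] -/
def TwoPointSectorComplete : Prop :=
  ∀ ⦃n m : ℕ⦄ (r : KZ.IntegralRep n) (r' : KZ.IntegralRep m), r.IsRational → r'.IsRational →
    r.value = r'.value →
    KZ.of r - KZ.of r' ∈ (KZ.relations ⊔ AddSubgroup.closure TorsionTied) ⊔ AddSubgroup.closure TwoPointTied

/-! ### Registered stubs -/

/-- **Stub 1 (M) — the common torsion grid.** Proof plan: reduce `a/N`, `a'/N'` (`gridData_torsion_arith`), `L := lcm`,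
mesh `δ := ω₁/(8L)`; `X(ω₁/L)` is algebraic because `ω₁/L = s·(ω₁/N₀) + t·(ω₁/N₀')` (Bezout) and `X(ω₁/N₀)`, `X(ω₁/N₀')`
are algebraic from `P`, `Q` (`gridData_alg_multiples`), then `gridData_alg_add`, three halvings `gridData_alg_half`, and
the floor's generic grid facts `gridData_grid_basic/chord/alg`, `gridData_tau_props`, `gridData_tau'_props` unchanged
(`Theorems/TorsionLogsNeronTorsionSectorStubGridData*.lean`). Why it might fail as typed: only bookkeeping risks (index
arithmetic in `ℕ` subtraction; `aa < aa'` is `u_P < u_Q`, i.e. `x_Q < x_P`). [cite: Lawden1989, §6.8] -/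
theorem stub_twoPointGrid : TwoPointGrid := by
  sorry

/-- **Stub 2 (L–XL, the rung's content) — the regular-end translation chain.** Proof plan: on the package grid run the
floor's corner-free blocks (Haar representations `stub_haarReps`, column/row dissections `AssemblyColumns/Rows`,
translation steps `AssemblyXSteps` with the cocycle `h∘τ − h = dQ̃` of `StubTranslationCalculus`, dlog unfolding
`StubDlogUnfold*`, log steps `StubLogStep/LogA/LogB`) from column `aa'` to column `aa`; the columns telescope to the two
boundary column classes; at `aa` proceed as the floor; at the REGULAR node `aa'` the boundary class is a first-kind ×
second-kind product `[x_Q<x<x_P, dx/y] × [e₁<x′<x_Q, x′dx′/y′]` (cf. the rectangle of `triangleConcatenation_proof`),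
whose first factor is `(p/q)·ω₁` by first-kind torsion interval relations (translation moves) and whose second factor is
`ϱ + (a'/N' − 1/2)·(complete second kind)` by the datum — giving `(2qp)•[rW]` plus `p²`-multiples of `[rP]`-columns plus
dlog carriers, with INTEGER coefficients because the grid is common (no division by `q_P², q_Q²`). Why it might fail: the
integer elimination may still leave a denominator `d` (only `d•(…)` a relation — saturation is Conjecture-1-strength on
this sector); the floor's elimination succeeded for `(q², p²)`, the mixed term `2qp` is new.
[cite: KontsevichZagier2001, §1.2] [cite: Lang1983, Ch. 13 Thm 1.1] [cite: Lawden1989, §6.11–6.12] -/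
theorem stub_regularEndChain : RegularEndChain := by
  sorry

/-- **Stub 3 (residual, conjecture-grade) — completeness relative to the ENLARGED sector.** Weaker than the crux
(`twoPointSectorComplete_of_torsionSectorComplete`), a consequence of the summit, in substance Conjecture 1 modulo an
explicit proved sector: declared `residual`. Why it might fail: not short of the summit failing; it can fail to be
PROVABLE (the kernel of the period map is not known to be generated by explicit sectors — Ayoub, Huber–Müller-Stach).
[cite: KontsevichZagier2001, §1.2] [cite: Ayoub2014, Cor. 32] -/
theorem stub_twoPointComplete : TwoPointSectorComplete := by
  sorry

/-! ### Helper lemmas (proved) -/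

/-- A dimension-1 representation with domain `{t | e < t 0}` certifies `e` algebraic. [folklore] -/
theorem isAlgebraic_of_Ioi_rep {e : ℝ} (r : KZ.IntegralRep 1) (hd : r.domain = {t | e < t 0}) :
    IsAlgebraic ℚ e := by
  set E := Homeomorph.funUnique (Fin 1) ℝ with hE
  have hse : {t : Fin 1 → ℝ | e < t 0} = E ⁻¹' Ioi e := by
    ext t
    simp [hE, Fin.default_eq_zero]
  have hfr : frontier {t : Fin 1 → ℝ | e < t 0} = E ⁻¹' {e} := by
    rw [hse, ← E.preimage_frontier, frontier_Ioi]
  refine isAlgebraic_of_mem_frontier (x := fun _ : Fin 1 => e) r.isSemialgebraic_domain ?_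
  rw [hd, hfr]
  simp [hE]

/-- `g₂, g₃` are algebraic as soon as the triangle representation `rI(Q→P)` exists (three rational fibres of the
semialgebraic integrand; the floor's `stub_parametersAlgebraic` argument without `f e = 0`). [folklore] -/
theorem isAlgebraic_g_of_integralRep {g₂ g₃ e xP : ℝ} {f : ℝ → ℝ} (hf : ∀ x, f x = 4 * x ^ 3 - g₂ * x - g₃)
    (he : 0 ≤ e) (hpos : ∀ x, e < x → 0 < f x) (hxP : e < xP) (rI : KZ.IntegralRep 2)
    (hdom : rI.domain = {z | e < z 1 ∧ z 1 < z 0 ∧ z 0 < xP})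
    (hint : Set.EqOn rI.integrand (fun z => z 1 / (Real.sqrt (f (z 1)) * Real.sqrt (f (z 0)))) rI.domain) :
    IsAlgebraic ℚ g₂ ∧ IsAlgebraic ℚ g₃ := by
  obtain ⟨x₁, h01, h1P⟩ := exists_rat_btwn hxP
  obtain ⟨x₂, h12, h2P⟩ := exists_rat_btwn h1P
  obtain ⟨x₃, h23, h3P⟩ := exists_rat_btwn h2P
  have A12 : IsAlgebraic ℚ (f x₁ * f x₂) := isAlgebraic_mul_of_integralRep he hpos rI hdom hint h01 h12 h2P
  have A13 : IsAlgebraic ℚ (f x₁ * f x₃) :=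
    isAlgebraic_mul_of_integralRep he hpos rI hdom hint h01 (h12.trans h23) h3P
  have A23 : IsAlgebraic ℚ (f x₂ * f x₃) :=
    isAlgebraic_mul_of_integralRep he hpos rI hdom hint (h01.trans h12) h23 h3P
  have hf1 : f x₁ ≠ 0 := (hpos _ h01).ne'
  have hf2 : f x₂ ≠ 0 := (hpos _ (h01.trans h12)).ne'
  have hf3 : f x₃ ≠ 0 := (hpos _ ((h01.trans h12).trans h23)).ne'
  have hsq : f x₁ ^ 2 = f x₁ * f x₂ * (f x₁ * f x₃) * (f x₂ * f x₃)⁻¹ := by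
    field_simp
  have B1 : IsAlgebraic ℚ (f x₁) :=
    IsAlgebraic.of_pow two_pos (by rw [hsq]; exact (A12.mul A13).mul A23.inv)
  have B2 : IsAlgebraic ℚ (f x₂) := by
    have h : f x₂ = (f x₁)⁻¹ * (f x₁ * f x₂) := by field_simp
    rw [h]
    exact B1.inv.mul A12
  have h4 : IsAlgebraic ℚ (4 : ℝ) := by exact_mod_cast isAlgebraic_rat ℚ (4 : ℚ)
  have Hb1 : IsAlgebraic ℚ (4 * (x₁ : ℝ) ^ 3 - f x₁) := (h4.mul ((isAlgebraic_rat ℚ x₁).pow 3)).sub B1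
  have Hb2 : IsAlgebraic ℚ (4 * (x₂ : ℝ) ^ 3 - f x₂) := (h4.mul ((isAlgebraic_rat ℚ x₂).pow 3)).sub B2
  have hx12 : (x₂ : ℝ) - x₁ ≠ 0 := sub_ne_zero.2 (ne_of_gt h12)
  have hg₂ : g₂ = ((4 * (x₂ : ℝ) ^ 3 - f x₂) - (4 * (x₁ : ℝ) ^ 3 - f x₁)) * ((x₂ : ℝ) - x₁)⁻¹ := by
    rw [hf, hf, eq_mul_inv_iff_mul_eq₀ hx12]
    ring
  have G2 : IsAlgebraic ℚ g₂ := by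
    rw [hg₂]
    exact (Hb2.sub Hb1).mul ((isAlgebraic_rat ℚ x₂).sub (isAlgebraic_rat ℚ x₁)).inv
  have hg₃ : g₃ = (4 * (x₁ : ℝ) ^ 3 - f x₁) - g₂ * x₁ := by
    rw [hf]
    ring
  have G3 : IsAlgebraic ℚ g₃ := by
    rw [hg₃]
    exact Hb1.sub (G2.mul (isAlgebraic_rat ℚ x₁))
  exact ⟨G2, G3⟩

/-! ### The rung from stubs 1–2 -/

set_option maxHeartbeats 800000 in
/-- **`NeronTorsionTwoPoint` from the two stubs** (`<Rung>_of`, no `sorry` of its own): the degenerate member `x_Q = e₁`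
(forced `N' = 2a'`, `ϱ = 0`, slope `= 1/2 − a/N`) is the FLOOR `stub_assembly` by name plus `[rW] ∈ relations`
(zero integrand); the regular member `e₁ < x_Q` reads the algebraicity of `g₂, g₃, e₁, x_P, x_Q` off the three
representations, takes the common grid (stub 1), the regular-end chain (stub 2), and packages the integer log family as
one carrier `c·[1<t<B, dt/t]` by the landed `exists_carrier_of_logFamily` (Baker/Hermite–Lindemann inside).
[cite: KontsevichZagier2001, §1.2] -/
theorem neronTorsionTwoPoint_of (h₁ : TwoPointGrid) (h₂ : RegularEndChain) : NeronTorsionTwoPoint := by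
  intro N' g₂ g₃ e₁ xP yP xQ yQ ϱ N a a' p q f hf hΔ he₁ he₁pos hfpos hxP hyP hN ha haN hordP hintP
    hxQ hxQP hyQ hN' ha' ha'N' hordQ hintQ hEtaQ hcop hpq rI rP rW hrId hrIi hrPd hrPi hrWd hrWi
  obtain ⟨ω, X, Y, hω, hωint, -, -, -, -, -, -, -, -, -, -, hsurj, hint, -⟩ :=
    stub_realDictionary g₂ g₃ e₁ f hf hΔ he₁ hfpos
  set I₀ : ℝ := ∫ x in Ioi e₁, (Real.sqrt (f x))⁻¹ with hI₀
  have hI₀pos : 0 < I₀ := by linarith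
  have hWrel : ϱ = 0 → KZ.of rW ∈ KZ.relations := fun hϱ =>
    KZ.of_mem_relations_of_eqOn_zero rW fun t ht => by
      rw [hrWi ht]
      simp [hϱ]
  have hN'r : (0 : ℝ) < N' := by exact_mod_cast (show 0 < N' by omega)
  rcases hxQ.eq_or_lt with hxQe | hxQlt
  · -- DEGENERATE MEMBER `x_Q = e₁`: the floor.
    have h2a' : (N' : ℝ) = 2 * a' := by
      rw [← hxQe] at hintQ
      have : ((N' : ℝ) - 2 * a') * I₀ = 0 := by rw [sub_mul]; linarith
      rcases mul_eq_zero.mp this with h1 | h1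
      · linarith
      · exact absurd h1 hI₀pos.ne'
    have hϱ : ϱ = 0 := by
      rw [← hxQe, Set.Ioo_self, Measure.restrict_empty, integral_zero_measure] at hEtaQ
      have hc : (a' : ℝ) / N' - 1 / 2 = 0 := by
        rw [h2a']
        have : (a' : ℝ) ≠ 0 := by exact_mod_cast ha'.ne'
        field_simp
        ring
      rw [hc, zero_mul, add_zero] at hEtaQ
      exact hEtaQ.symm
    have hqN : (q : ℤ) * ((N : ℤ) - 2 * (a : ℤ)) = (p : ℤ) * (2 * (N : ℤ)) := by
      have h2a'Z : (N' : ℤ) = 2 * a' := by exact_mod_cast (show (N' : ℝ) = 2 * a' from h2a')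
      rw [h2a'Z] at hpq
      have ha'Z : (a' : ℤ) ≠ 0 := by exact_mod_cast ha'.ne'
      have : (a' : ℤ) * ((q : ℤ) * ((N : ℤ) - 2 * (a : ℤ)) - (p : ℤ) * (2 * (N : ℤ))) = 0 := by
        linear_combination hpq
      rcases mul_eq_zero.mp this with h1 | h1
      · exact absurd h1 ha'Z
      · linarith
    rw [← hxQe] at hrId
    obtain ⟨c, B, rB, hB1, hBalg, hrBd, hrBi, hmem⟩ := stub_assembly g₂ g₃ e₁ xP yP N a p q f hf hΔ he₁
      he₁pos hfpos hxP hyP hN ha haN hordP hintP hcop hqN rI rP hrId hrIi hrPd hrPi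
    refine ⟨c, B, rB, hB1, hBalg, hrBd, hrBi, ?_⟩
    have e : ((q : ℤ) ^ 2) • KZ.of rI + ((p : ℤ) ^ 2) • KZ.of rP + (2 * (q : ℤ) * p) • KZ.of rW - c • KZ.of rB
        = (((q : ℤ) ^ 2) • KZ.of rI + ((p : ℤ) ^ 2) • KZ.of rP - c • KZ.of rB) + (2 * (q : ℤ) * p) • KZ.of rW := by
      abel
    rw [e]
    exact add_mem hmem (AddSubgroup.zsmul_mem _ (hWrel hϱ) _)
  · -- REGULAR MEMBER `e₁ < x_Q`: stubs 1–2 and the landed log packaging.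
    obtain ⟨uQ, huQ, hXuQ⟩ := hsurj xQ hxQlt
    have hIQ : ∫ x in Ioi xQ, (Real.sqrt (f x))⁻¹ = uQ := by
      have h1 := hint uQ ⟨huQ.1, huQ.2.le⟩
      rwa [hXuQ] at h1
    have hNuQ : (N' : ℝ) * uQ = a' * (2 * I₀) := by rw [← hIQ]; exact hintQ
    have h2a'r : 2 * (a' : ℝ) < N' := by
      by_contra hc
      push Not at hc
      have h1 : (N' : ℝ) * uQ < N' * (ω / 2) := mul_lt_mul_of_pos_left huQ.2 hN'r
      rw [hNuQ, hωint] at h1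
      nlinarith [mul_le_mul_of_nonneg_right hc hI₀pos.le]
    have h2a' : 2 * a' < N' := by exact_mod_cast h2a'r
    have hN'3 : 3 ≤ N' := by omega
    obtain ⟨HxQ, HxP⟩ := isAlgebraic_endpoints_of_isSemialgebraic_Ioo hxQP
      (isSemialgebraic_proj_triangle rI.isSemialgebraic_domain hrId)
    obtain ⟨G2, G3⟩ := isAlgebraic_g_of_integralRep hf (he₁pos.le.trans hxQ)
      (fun x hx => hfpos x (lt_of_le_of_lt hxQ hx)) hxQP rI hrId hrIi
    have He₁ : IsAlgebraic ℚ e₁ := isAlgebraic_of_Ioi_rep rW hrWd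
    obtain ⟨n, m, aa, aa', x, y, hG⟩ := h₁ g₂ g₃ e₁ xP xQ N a N' a' f hf hΔ he₁ he₁pos hfpos G2 G3 He₁
      hxP HxP hN ha haN hintP hxQlt hxQP HxQ hN'3 ha' h2a' hintQ
    obtain ⟨κ, α, β, ε, cs, hα, hαβ, halgα, halgβ, hdom, hone, hmem⟩ := h₂ g₂ g₃ e₁ xP yP xQ yQ ϱ N a N' a'
      p q f hf hΔ he₁ he₁pos hfpos hxP hyP hN ha haN hordP hintP hxQlt hxQP hyQ hN'3 ha' h2a' hordQ hintQ hEtaQ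
      hcop hpq G2 G3 He₁ HxP HxQ n m aa aa' x y hG rI rP rW hrId hrIi hrPd hrPi hrWd hrWi
    exact exists_carrier_of_logFamily _ α β ε cs hα hαβ halgα halgβ hdom hone hmem

/-! ### The residual side -/

/-- The rung folds the tied two-point elements into the moves: `closure T₂ ≤ KZ.relations` (rung + soundness
`KZ.relations_le_ker_eval_holds` + the landed exact log relation `interval_log_relation_mem_relations` to exchange
the carrier). [cite: KontsevichZagier2001, §1.2] -/
theorem closure_twoPointTied_le_relations (h : NeronTorsionTwoPoint) :
    AddSubgroup.closure TwoPointTied ≤ KZ.relations := by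
  refine (AddSubgroup.closure_le _).mpr ?_
  rintro d ⟨N', g₂, g₃, e₁, xP, yP, xQ, yQ, ϱ, N, a, a', p, q, f, rI, rP, rW, rB, c, B, hf, hΔ, he₁, he₁pos,
    hfpos, hxP, hyP, hN, ha, haN, hordP, hintP, hxQ, hxQP, hyQ, hN', ha', ha'N', hordQ, hintQ, hEtaQ, hcop, hpq,
    hrId, hrIi, hrPd, hrPi, hrWd, hrWi, hB1, hBalg, hrBd, hrBi, hval, rfl⟩
  obtain ⟨c₀, B₀, rB₀, hB₀1, hB₀alg, hrB₀d, hrB₀i, hmem⟩ := h N' g₂ g₃ e₁ xP yP xQ yQ ϱ N a a' p q f hf hΔ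
    he₁ he₁pos hfpos hxP hyP hN ha haN hordP hintP hxQ hxQP hyQ hN' ha' ha'N' hordQ hintQ hEtaQ hcop hpq rI rP
    rW hrId hrIi hrPd hrPi hrWd hrWi
  have hv₀ : rB₀.value = Real.log B₀ := logRep_value hB₀1.le rB₀ hrB₀d hrB₀i
  have hv : rB.value = Real.log B := logRep_value hB1.le rB hrBd hrBi
  have e0 : (q : ℝ) ^ 2 * rI.value + (p : ℝ) ^ 2 * rP.value + 2 * (q : ℝ) * p * rW.value - c₀ * Real.log B₀ = 0 := by
    have h1 := KZ.relations_le_ker_eval_holds hmem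
    rw [AddMonoidHom.mem_ker] at h1
    simpa only [map_add, map_sub, map_zsmul, KZ.eval_of, zsmul_eq_mul, Int.cast_pow, Int.cast_natCast,
      Int.cast_mul, Int.cast_ofNat, hv₀] using h1
  have hlog : (c₀ : ℝ) * Real.log B₀ - c * Real.log B = 0 := by
    rw [hv] at hval
    linarith
  have hsum : ∑ i : Fin 2, (![c₀, -c] i) • KZ.of ((![rB₀, rB]) i) = c₀ • KZ.of rB₀ + (-c) • KZ.of rB := by
    rw [Fin.sum_univ_two]
    rfl
  have hrel : c₀ • KZ.of rB₀ + (-c) • KZ.of rB ∈ KZ.relations := by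
    rw [← hsum]
    refine interval_log_relation_mem_relations 2 (fun _ => (1 : ℝ)) ![B₀, B] ![c₀, -c] ![rB₀, rB]
      (fun _ => one_pos) (Fin.forall_fin_two.2 ⟨hB₀1.le, hB1.le⟩) (fun _ => isAlgebraic_one)
      (Fin.forall_fin_two.2 ⟨hB₀alg, hBalg⟩)
      (Fin.forall_fin_two.2
        ⟨⟨hrB₀d, fun t ht => show rB₀.integrand t = 1 / t 0 by rw [hrB₀i ht, one_div]⟩,
         ⟨hrBd, fun t ht => show rB.integrand t = 1 / t 0 by rw [hrBi ht, one_div]⟩⟩) ?_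
    rw [Fin.sum_univ_two]
    simp only [Matrix.cons_val_zero, Matrix.cons_val_one, div_one, Int.cast_neg]
    linarith
  have e : ((q : ℤ) ^ 2) • KZ.of rI + ((p : ℤ) ^ 2) • KZ.of rP + (2 * (q : ℤ) * p) • KZ.of rW - c • KZ.of rB
      = (((q : ℤ) ^ 2) • KZ.of rI + ((p : ℤ) ^ 2) • KZ.of rP + (2 * (q : ℤ) * p) • KZ.of rW - c₀ • KZ.of rB₀)
        + (c₀ • KZ.of rB₀ + (-c) • KZ.of rB) := by
    rw [neg_zsmul]
    abel
  rw [e]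
  exact add_mem hmem hrel

/-- The residual is a consequence of the crux (hence of the summit): monotonicity of `⊔`.
(Informational: stub 3 is WEAKER than the crux.) [folklore] -/
theorem twoPointSectorComplete_of_torsionSectorComplete (h : TorsionSectorComplete) : TwoPointSectorComplete :=
  fun _ _ r r' hr hr' hv => AddSubgroup.mem_sup_left (h r r' hr hr' hv)

/-- The residual also follows from the summit directly. [folklore] -/
theorem twoPointSectorComplete_of_kontsevichZagierPeriods (h : _root_.KontsevichZagierPeriods) :
    TwoPointSectorComplete :=
  twoPointSectorComplete_of_torsionSectorComplete
    (Summit.KontsevichZagierPeriods.TorsionLogs.TorsionSectorComplete.of_summit h)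

/-! ### Composition: the crux BY NAME from the three stubs -/

/-- **`TorsionSectorComplete` from the stubs** (closed term; `sorry` only through `stub_twoPointGrid`,
`stub_regularEndChain`, `stub_twoPointComplete`): the rung (stubs 1–2, `neronTorsionTwoPoint_of`) folds the
two-point tied set into the moves (`closure TwoPointTied ≤ relations`), so the residual's
`(relations ⊔ closure TorsionTied) ⊔ closure TwoPointTied` is already `≤ relations ⊔ closure TorsionTied`.
[cite: KontsevichZagier2001, §1.2] -/
theorem TorsionSectorComplete_of :
    Summit.KontsevichZagierPeriods.KontsevichZagierPeriods.Theses.TorsionLogs.TorsionSectorComplete := by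
  suffices key : TwoPointGrid → RegularEndChain → TwoPointSectorComplete →
      Summit.KontsevichZagierPeriods.KontsevichZagierPeriods.Theses.TorsionLogs.TorsionSectorComplete from
    key stub_twoPointGrid stub_regularEndChain stub_twoPointComplete
  intro h₁ h₂ h₃ n m r r' hr hr' hv
  have hR : NeronTorsionTwoPoint := neronTorsionTwoPoint_of h₁ h₂
  have hle : (KZ.relations ⊔ AddSubgroup.closure TorsionTied) ⊔ AddSubgroup.closure TwoPointTied ≤
      KZ.relations ⊔ AddSubgroup.closure TorsionTied :=
    sup_le le_rfl ((closure_twoPointTied_le_relations hR).trans le_sup_left)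
  exact hle (h₃ r r' hr hr' hv)

/-- The rung itself from the registered stubs (closed term). -/
theorem neronTorsionTwoPoint_holds : NeronTorsionTwoPoint :=
  neronTorsionTwoPoint_of stub_twoPointGrid stub_regularEndChain

end Summit.KontsevichZagierPeriods.KontsevichZagierPeriods.Cruxes.TorsionSectorComplete.NeronTorsionTwoPoint
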